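import Summits.CriticalPhenomena.SAWScalingLimit.Theses.SAWThetaPercolation
import Summits.CriticalPhenomena.SAWScalingLimit.Theses.SAWHexUniversality
import Summits.CriticalPhenomena.SAWScalingLimit.Theorems.SAWMassiveIsingTiltHexEndpointApproxExists
import Summits.CriticalPhenomena.SAWScalingLimit.Theorems.SubseqIdentification.Negative.ProbabilityRedundant
import Summits.CriticalPhenomena.SAWScalingLimit.Theorems.SubseqIdentification.Negative.CoincidentEndpointLaw
import Summits.CriticalPhenomena.SAWScalingLimit.Theorems.ObservableToSLE.Negative.Identification
import Summits.CriticalPhenomena.SAWScalingLimit.Theorems.YBtoUniform.Negative.FalseWithoutYBApprox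
import Literature.Probability.RandomPlanarGeometry.SAWScalingLimitFamily
import Literature.Probability.RandomPlanarGeometry.SLEUniquenessInLaw

/-!
# `LatticeUniversality` (stmt-CriticalPhenomena-0807): refutation cost and load-bearing hypotheses

Refuter crux-attack at birth (route `SAWThetaPercolation`, vetting cycle 1) for the shared crux

  `LatticeUniversality` — for every Dobrushin domain `D`, every `δℤ²` endpoint approximation `(a, b)`
  and every hexagonal one `(a', b')`, and every bounded continuous `f` on `CurveClass ℂ`,
  `∫ f∘curve dP^{ℤ²}_δ − ∫ f∘curve dP^{Hex}_δ → 0` as `δ → 0⁺`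

(identical bodies in `Theses.SAWThetaPercolation / .SAWHexUniversality / .SAWMassiveIsingTilt /
.SAWResidueField / .SAWBetheAnsatz / .SAWTurnDefect`). No conclusion below asserts a Theses decl
positively.

* §1 ONE STATEMENT: the new `SAWThetaPercolation` copy is syntactically the `SAWHexUniversality` copy
  (`Iff.rfl`), so every earlier stamp / negative lemma on item 0807 applies verbatim.
* §2 NON-VACUITY: the hypotheses are satisfiable in EVERY Dobrushin domain
  (`SAW.exists_isEndpointApprox`, `HexEndpointApprox.exists_isEmbEndpointApprox`, both landed), and
  on constant test functions the claim holds (both laws are eventually probability measures — no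
  junk-`0` law, no mass mismatch).
* §3 REFUTATION COST: `¬ LatticeUniversality → ¬ (SAWScalingLimit ∧ HexSAWScalingLimit)` — the crux
  follows from the two standard conjectures (LSW Prediction 1 on `δℤ²` = the audited sub-problem
  statement, and Duminil-Copin–Smirnov Conjecture 1 on `δℍ`) by uniqueness in law of chordal
  SLE_{8/3} in a Dobrushin domain (`IsSLECurve.map_eq_holds`, proved in tree); so a refutation of the
  crux refutes one of them. (Cf. the sibling accounting `HexTransfer.Negative.RefutationCost`, p95732,
  and `Cruxes.HexTransfer.Sandwich.hexTransfer_iff_imp`: given DCS Conjecture 1 the crux IS the summit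
  conjunct.)
* §4 LOAD-BEARING HYPOTHESES: each endpoint-approximation hypothesis is load-bearing — the crux with
  the binder `IsEndpointApprox D a b →` deleted is FALSE (`latticeUniversality_false_without_endpointApprox`:
  `a = b ≡ 0` pins the `δℤ²` law on the trivial walk drawn at `0`, while an honest hexagonal
  approximation of `(𝔻; 1, -1)` starts its curves near `1`), and symmetrically with
  `IsEmbEndpointApprox hexGraph hexCenter D a' b' →` deleted
  (`latticeUniversality_false_without_embEndpointApprox`). Test function `min 1 ‖source‖` as in
  `YBtoUniform.Negative.ybtoUniform_false_without_ybApprox`. The two endpoint approximations are the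
  only link between the two laws in the statement; nothing else can be dropped.
-/

noncomputable section

namespace Summit.CriticalPhenomena.SAWScalingLimit.Theorems.LatticeUniversality.Negative

open MeasureTheory Filter Topology Set
open Literature.Probability.LatticeModels Literature.Probability.RandomPlanarGeometry
open Literature.Probability.RandomPlanarGeometry.SAW
open Summit.CriticalPhenomena.SAWScalingLimit.Theses
open Summit.CriticalPhenomena.SAWScalingLimit.Theorems.HexEndpointApprox (exists_isEmbEndpointApprox)
open Summit.CriticalPhenomena.SAWScalingLimit.Theorems.YBtoUniform.Negative (source_curve_domainSAW)
open scoped NNReal ENNReal BoundedContinuousFunction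

/-! ### §1 One statement -/

/-- The `SAWThetaPercolation` copy of the crux (route opened 2026-08-17) is, syntactically, the
`SAWHexUniversality` copy (the skeleton's `crux_decl`). [folklore] -/
theorem thetaPercolation_iff_hexUniversality :
    SAWThetaPercolation.LatticeUniversality ↔ SAWHexUniversality.LatticeUniversality :=
  Iff.rfl

/-! ### §2 Non-vacuity and the constant test function -/

/-- The hypotheses of the crux are satisfiable in every Dobrushin domain: a `δℤ²` endpoint
approximation and a hexagonal one always exist. [folklore] -/
theorem hyps_satisfiable (D : DobrushinDomain) :
    ∃ (a b : ℝ → Site 2) (a' b' : ℝ → HexVertex),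
      IsEndpointApprox D a b ∧ IsEmbEndpointApprox hexGraph hexCenter D a' b' := by
  obtain ⟨a, b, h⟩ := SAW.exists_isEndpointApprox D
  obtain ⟨a', b', h'⟩ := exists_isEmbEndpointApprox D
  exact ⟨a, b, a', b', h, h'⟩

/-- On a constant test function the crux's conclusion holds: both critical laws are eventually
probability measures along `𝓝[>] 0`, so their masses merge (no junk-`0` law on either side).
[folklore] -/
theorem tendsto_sub_const (D : DobrushinDomain) (a b : ℝ → Site 2) (a' b' : ℝ → HexVertex)
    (hab : IsEndpointApprox D a b) (hab' : IsEmbEndpointApprox hexGraph hexCenter D a' b') (c : ℝ) :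
    Tendsto (fun δ => (∫ γ, (BoundedContinuousFunction.const (CurveClass ℂ) c) γ.curve
        ∂(law D.carrier δ (a δ) (b δ))) -
      ∫ γ, (BoundedContinuousFunction.const (CurveClass ℂ) c) γ.curve
        ∂(hexSAWLaw D.carrier δ (a' δ) (b' δ))) (𝓝[>] (0 : ℝ)) (𝓝 0) := by
  have h1 := SubseqIdentification.Negative.eventually_isProbabilityMeasure_law hab
  have h2 := ObservableToSLE.Negative.eventually_isProbabilityMeasure_hexSAWLaw hab'
  refine tendsto_const_nhds.congr' ?_
  filter_upwards [h1, h2] with δ hP hQ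
  haveI := hP
  haveI := hQ
  simp

/-! ### §3 Refutation cost -/

/-- **What a refutation of the crux costs**: `¬ LatticeUniversality` refutes the conjunction of the two
standard conjectures — LSW's Prediction 1 on `δℤ²` (the sub-problem statement `SAWScalingLimit`) and
Duminil-Copin–Smirnov's Conjecture 1 on `δℍ` (`HexSAWScalingLimit`). Indeed both lattice laws would
converge in law to chordal SLE_{8/3} random curves of the same Dobrushin domain, which are equal in
law (`IsSLECurve.map_eq_holds`), so the test integrals have a common limit. [folklore] -/
theorem not_conjectures_of_not_latticeUniversality (h : ¬ SAWThetaPercolation.LatticeUniversality) :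
    ¬ (_root_.SAWScalingLimit ∧ HexSAWScalingLimit) := by
  rintro ⟨hS, hH⟩
  apply h
  intro D a b a' b' hab hab' f
  obtain ⟨Γ, hΓ, -, hT⟩ := hS D a b hab
  obtain ⟨Γ', hΓ', -, hT'⟩ := hH D a' b' hab'
  have hlaw : Literature.Probability.Process.preWienerMeasure.map Γ =
      Literature.Probability.Process.preWienerMeasure.map Γ' :=
    IsSLECurve.map_eq_holds hΓ hΓ'
  have hint : ∫ ω, f (Γ ω) ∂Literature.Probability.Process.preWienerMeasure =
      ∫ ω, f (Γ' ω) ∂Literature.Probability.Process.preWienerMeasure := by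
    rw [← integral_map hΓ.aemeasurable f.continuous.aestronglyMeasurable,
      ← integral_map hΓ'.aemeasurable f.continuous.aestronglyMeasurable, hlaw]
  have hsub := (hT f).sub (hT' f)
  rw [hint, sub_self] at hsub
  exact hsub

/-- Equivalently: the crux is refutable only by refuting the summit conjunct or DCS Conjecture 1.
[folklore] -/
theorem not_latticeUniversality_imp (h : ¬ SAWThetaPercolation.LatticeUniversality) :
    ¬ _root_.SAWScalingLimit ∨ ¬ HexSAWScalingLimit :=
  not_and_or.mp (not_conjectures_of_not_latticeUniversality h)

/-! ### §4 Load-bearing hypotheses -/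

/-- Every hexagonal SAW curve of `Ω_δ` from `a` to `b` starts at `δ · hexCenter a`. [folklore] -/
theorem source_curve_hexDomainSAW {Ω : Set ℂ} {δ : ℝ} {a b : HexVertex} (γ : HexDomainSAW Ω δ a b) :
    γ.curve.source = (δ : ℂ) * hexCenter a := by
  show (γ.walk.toCurve fun v => (δ : ℂ) * hexCenter v) 0 = (δ : ℂ) * hexCenter a
  exact SimpleGraph.Walk.toCurve_apply_zero _ _

/-- There is a bounded continuous test function `γ ↦ min 1 ‖γ.source‖` on `CurveClass ℂ`
(`CurveClass.source` is continuous). [folklore] -/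
theorem exists_srcTest :
    ∃ F : BoundedContinuousFunction (CurveClass ℂ) ℝ, ∀ γ, F γ = min 1 ‖γ.source‖ :=
  ⟨BoundedContinuousFunction.mkOfBound
    ⟨fun γ => min 1 ‖γ.source‖,
      continuous_const.min (continuous_norm.comp CurveClass.continuous_source)⟩
    1 (fun γ₁ γ₂ => by
      simp only [ContinuousMap.coe_mk, Real.dist_eq]
      have h1 : 0 ≤ min 1 ‖γ₁.source‖ := le_min zero_le_one (norm_nonneg _)
      have h2 : 0 ≤ min 1 ‖γ₂.source‖ := le_min zero_le_one (norm_nonneg _)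
      have h3 : min 1 ‖γ₁.source‖ ≤ 1 := min_le_left _ _
      have h4 : min 1 ‖γ₂.source‖ ≤ 1 := min_le_left _ _
      rw [abs_le]; constructor <;> linarith), fun _ => rfl⟩

/-- With an honest hexagonal endpoint approximation of `(𝔻; 1, -1)`, the hexagonal test integrals
of `min 1 ‖source‖` tend to `min 1 ‖1‖ = 1`. [folklore] -/
theorem tendsto_integral_srcTest_hex {F : BoundedContinuousFunction (CurveClass ℂ) ℝ}
    (hF : ∀ γ, F γ = min 1 ‖γ.source‖) {a' b' : ℝ → HexVertex}
    (hab' : IsEmbEndpointApprox hexGraph hexCenter DobrushinDomain.unitDisc a' b') :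
    Tendsto (fun δ : ℝ => ∫ γ, F γ.curve
        ∂(hexSAWLaw DobrushinDomain.unitDisc.carrier δ (a' δ) (b' δ))) (𝓝[>] (0 : ℝ)) (𝓝 1) := by
  have hev : ∀ᶠ δ in 𝓝[>] (0 : ℝ),
      ∫ γ, F γ.curve ∂(hexSAWLaw DobrushinDomain.unitDisc.carrier δ (a' δ) (b' δ)) =
        min 1 ‖(δ : ℂ) * hexCenter (a' δ)‖ := by
    filter_upwards [ObservableToSLE.Negative.eventually_isProbabilityMeasure_hexSAWLaw hab'] with δ hP
    have hconst : ∀ γ : HexDomainSAW DobrushinDomain.unitDisc.carrier δ (a' δ) (b' δ),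
        F γ.curve = min 1 ‖(δ : ℂ) * hexCenter (a' δ)‖ := by
      intro γ
      rw [hF, source_curve_hexDomainSAW]
    simp [hconst]
  have hlim : Tendsto (fun δ : ℝ => min 1 ‖(δ : ℂ) * hexCenter (a' δ)‖) (𝓝[>] (0 : ℝ))
      (𝓝 (min 1 ‖DobrushinDomain.unitDisc.pt 0‖)) :=
    ((continuous_const.min continuous_norm).tendsto _).comp hab'.tendsto_fst
  rw [SubseqIdentification.Negative.unitDisc_pt.1, norm_one, min_self] at hlim
  exact hlim.congr' (hev.mono fun δ hδ => hδ.symm)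

/-- With an honest `δℤ²` endpoint approximation of `(𝔻; 1, -1)`, the `δℤ²` test integrals of
`min 1 ‖source‖` tend to `min 1 ‖1‖ = 1`. [folklore] -/
theorem tendsto_integral_srcTest_sq {F : BoundedContinuousFunction (CurveClass ℂ) ℝ}
    (hF : ∀ γ, F γ = min 1 ‖γ.source‖) {a b : ℝ → Site 2}
    (hab : IsEndpointApprox DobrushinDomain.unitDisc a b) :
    Tendsto (fun δ : ℝ => ∫ γ, F γ.curve
        ∂(law DobrushinDomain.unitDisc.carrier δ (a δ) (b δ))) (𝓝[>] (0 : ℝ)) (𝓝 1) := by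
  have hev : ∀ᶠ δ in 𝓝[>] (0 : ℝ),
      ∫ γ, F γ.curve ∂(law DobrushinDomain.unitDisc.carrier δ (a δ) (b δ)) =
        min 1 ‖meshPoint δ (a δ)‖ := by
    filter_upwards [SubseqIdentification.Negative.eventually_isProbabilityMeasure_law hab] with δ hP
    have hconst : ∀ γ : DomainSAW DobrushinDomain.unitDisc.carrier δ (a δ) (b δ),
        F γ.curve = min 1 ‖meshPoint δ (a δ)‖ := by
      intro γ
      rw [hF, source_curve_domainSAW]
    simp [hconst]
  have hlim : Tendsto (fun δ : ℝ => min 1 ‖meshPoint δ (a δ)‖) (𝓝[>] (0 : ℝ))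
      (𝓝 (min 1 ‖DobrushinDomain.unitDisc.pt 0‖)) :=
    ((continuous_const.min continuous_norm).tendsto _).comp hab.tendsto_fst
  rw [SubseqIdentification.Negative.unitDisc_pt.1, norm_one, min_self] at hlim
  exact hlim.congr' (hev.mono fun δ hδ => hδ.symm)

/-- **`IsEndpointApprox D a b` is load-bearing**: the crux with the binder `IsEndpointApprox D a b →`
deleted (everything else verbatim) is FALSE. Witness: `D = (𝔻; 1, -1)`, `a = b ≡ 0` (the only SAW from
`0` to `0` is trivial and is drawn at `meshPoint δ 0 = 0`, so `min 1 ‖source‖` integrates to `0` at EVERY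
mesh, whatever the normalisation), an honest hexagonal endpoint approximation (it exists), `f = min 1 ‖source‖`:
the difference tends to `-1`, not `0`. [folklore] -/
theorem latticeUniversality_false_without_endpointApprox :
    ¬ (∀ (D : DobrushinDomain) (a b : ℝ → Site 2) (a' b' : ℝ → HexVertex),
        IsEmbEndpointApprox hexGraph hexCenter D a' b' →
        ∀ f : BoundedContinuousFunction (CurveClass ℂ) ℝ,
          Tendsto (fun δ => (∫ γ, f γ.curve ∂(law D.carrier δ (a δ) (b δ))) -
            ∫ γ, f γ.curve ∂(hexSAWLaw D.carrier δ (a' δ) (b' δ))) (𝓝[>] (0 : ℝ)) (𝓝 0)) := by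
  intro h
  obtain ⟨F, hF⟩ := exists_srcTest
  obtain ⟨a', b', hab'⟩ := exists_isEmbEndpointApprox DobrushinDomain.unitDisc
  have key := h DobrushinDomain.unitDisc (fun _ => 0) (fun _ => 0) a' b' hab' F
  -- the `δℤ²` side vanishes identically: every SAW from `0` is drawn from `meshPoint δ 0 = 0`
  have hSq : ∀ δ : ℝ,
      ∫ γ, F γ.curve ∂(law DobrushinDomain.unitDisc.carrier δ 0 0) = 0 := by
    intro δ
    have h0 : meshPoint δ (0 : Site 2) = 0 := Complex.ext (by simp) (by simp)
    have hzero : ∀ γ : DomainSAW DobrushinDomain.unitDisc.carrier δ 0 0, F γ.curve = 0 := by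
      intro γ
      rw [hF, source_curve_domainSAW, h0, norm_zero]
      simp
    simp [hzero]
  have hlim : Tendsto (fun δ : ℝ =>
      (∫ γ, F γ.curve ∂(law DobrushinDomain.unitDisc.carrier δ ((fun _ : ℝ => (0 : Site 2)) δ)
          ((fun _ : ℝ => (0 : Site 2)) δ))) -
        ∫ γ, F γ.curve ∂(hexSAWLaw DobrushinDomain.unitDisc.carrier δ (a' δ) (b' δ)))
      (𝓝[>] (0 : ℝ)) (𝓝 (0 - 1)) := by
    refine (tendsto_const_nhds.sub (tendsto_integral_srcTest_hex hF hab')).congr' ?_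
    exact Eventually.of_forall fun δ => by simp only [hSq]
  have := tendsto_nhds_unique hlim key
  norm_num at this

/-- **`IsEmbEndpointApprox hexGraph hexCenter D a' b'` is load-bearing**: the crux with that binder
deleted is FALSE. Witness: `D = (𝔻; 1, -1)`, an honest `δℤ²` endpoint approximation (it exists),
`a' = b' ≡ v₀` a fixed face (for `δ > 0` the hexagonal law from `v₀` to `v₀` is a probability measure
— `v₀` is joined to itself — all of whose curves start at `δ · hexCenter v₀ → 0`), `f = min 1 ‖source‖`: the
difference tends to `1`, not `0`. [folklore] -/
theorem latticeUniversality_false_without_embEndpointApprox :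
    ¬ (∀ (D : DobrushinDomain) (a b : ℝ → Site 2) (a' b' : ℝ → HexVertex),
        IsEndpointApprox D a b →
        ∀ f : BoundedContinuousFunction (CurveClass ℂ) ℝ,
          Tendsto (fun δ => (∫ γ, f γ.curve ∂(law D.carrier δ (a δ) (b δ))) -
            ∫ γ, f γ.curve ∂(hexSAWLaw D.carrier δ (a' δ) (b' δ))) (𝓝[>] (0 : ℝ)) (𝓝 0)) := by
  intro h
  obtain ⟨F, hF⟩ := exists_srcTest
  obtain ⟨a, b, hab⟩ := SAW.exists_isEndpointApprox DobrushinDomain.unitDisc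
  set v₀ : HexVertex := ((0 : Site 2), (0 : Fin 2)) with hv₀
  have key := h DobrushinDomain.unitDisc a b (fun _ => v₀) (fun _ => v₀) hab F
  -- the hexagonal side: for `δ > 0` a probability measure whose curves all start at `δ · hexCenter v₀`
  have hHex : ∀ᶠ δ in 𝓝[>] (0 : ℝ),
      ∫ γ, F γ.curve ∂(hexSAWLaw DobrushinDomain.unitDisc.carrier δ v₀ v₀) =
        min 1 ‖(δ : ℂ) * hexCenter v₀‖ := by
    filter_upwards [self_mem_nhdsWithin] with δ hδ
    haveI := ObservableToSLE.Negative.isProbabilityMeasure_hexSAWLaw_of_reachable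
      DobrushinDomain.unitDisc.isBounded (ne_of_gt hδ) (SimpleGraph.Reachable.refl v₀
        (G := hexDomainGraph DobrushinDomain.unitDisc.carrier δ))
    have hconst : ∀ γ : HexDomainSAW DobrushinDomain.unitDisc.carrier δ v₀ v₀,
        F γ.curve = min 1 ‖(δ : ℂ) * hexCenter v₀‖ := by
      intro γ
      rw [hF, source_curve_hexDomainSAW]
    simp [hconst]
  have h0 : Tendsto (fun δ : ℝ => min 1 ‖(δ : ℂ) * hexCenter v₀‖) (𝓝[>] (0 : ℝ)) (𝓝 0) := by
    have hc : Continuous fun δ : ℝ => min 1 ‖(δ : ℂ) * hexCenter v₀‖ :=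
      continuous_const.min (continuous_norm.comp (Complex.continuous_ofReal.mul continuous_const))
    have := hc.tendsto 0
    simp only [Complex.ofReal_zero, zero_mul, norm_zero] at this
    rw [show min (1 : ℝ) 0 = 0 by norm_num] at this
    exact this.mono_left nhdsWithin_le_nhds
  have hlim : Tendsto (fun δ : ℝ =>
      (∫ γ, F γ.curve ∂(law DobrushinDomain.unitDisc.carrier δ (a δ) (b δ))) -
        ∫ γ, F γ.curve ∂(hexSAWLaw DobrushinDomain.unitDisc.carrier δ
          ((fun _ : ℝ => v₀) δ) ((fun _ : ℝ => v₀) δ)))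
      (𝓝[>] (0 : ℝ)) (𝓝 (1 - 0)) := by
    refine ((tendsto_integral_srcTest_sq hF hab).sub h0).congr' ?_
    filter_upwards [hHex] with δ hδ
    simp only [hδ]
  have := tendsto_nhds_unique hlim key
  norm_num at this

end Summit.CriticalPhenomena.SAWScalingLimit.Theorems.LatticeUniversality.Negative
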